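import Summits.BirchSwinnertonDyer.BirchSwinnertonDyer.Theorems.KolyvaginDepthDoorDepthTableRows1
import Summits.BirchSwinnertonDyer.BirchSwinnertonDyer.Theorems.KolyvaginDepthDoorDepthTableRows2
import HarnessLib

/-!
# Route `KolyvaginDepthDoor` — DEPTH TABLE, the second and third Kolyvagin primes of each row
# (1/3: `389a1`, `433a1`, `446d1`, `563a1`, `571b1`, `643a1`), kernel-certified (crux `KolyvaginDepthSupply`, stmt-BirchSwinnertonDyer-21765)

Helper file (`--supports stmt-BirchSwinnertonDyer-21765 --as helper`); it closes nothing and BSD is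
not proved by it. The route header asks the depth table for "the three smallest Kolyvagin primes ℓ
(inert, `p ∣ ℓ+1`, `p ∣ a_ℓ`)" per curve; the row files `KolyvaginDepthDoorDepthTableRows*` fix `(p, d_K)` and certify
the least one `ℓ₁` inside the full row certificate. This file certifies, for the same `(p, d_K)`, the
next two: `Zhang2014.IsKolyvaginPrime N_E E K p ℓ ∧ (1 : ℕ∞) ≤ levelIndex E p ℓ` for every quadratic
`K` with `d_K` as listed (kernel point count `#Ẽ(𝔽_ℓ)`, inertness by the Kronecker symbol, kit lemma
`isKolyvaginPrime_of_intModel_certificate`). Feeding any of them (with its `card_ℓ`) to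
`depthRow_of_intModel_certificate` gives the corresponding row verbatim.

| curve | `p` | `d_K` (`h_K`) | `ℓ₁` | `ℓ₂` (`a`) | `ℓ₃` (`a`) |
|---|---|---|---|---|---|
| `389a1` | `5` | `-7` (`1`) | `19` | `349` (`-10`) | `419` (`-35`) |
| `433a1` | `5` | `-8` (`1`) | `79` | `199` (`-10`) | `389` (`-25`) |
| `446d1` | `5` | `-23` (`3`) | `19` | `379` (`20`) | `1229` (`-10`) |
| `563a1` | `5` | `-8` (`1`) | `199` | `229` (`20`) | `239` (`10`) |
| `571b1` | `5` | `-8` (`1`) | `29` | `79` (`0`) | `149` (`-5`) |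
| `643a1` | `5` | `-8` (`1`) | `149` | `269` (`-15`) | `509` (`30`) |

References: [WZhang2014] Notations (xii); [GrossLMS1991] §3 (3.1)–(3.3); [CremonaAlgorithms1997] Table 1.
-/


set_option linter.dupNamespace false

noncomputable section

open scoped Classical NumberField

namespace Summit.BirchSwinnertonDyer.BirchSwinnertonDyer.Theorems.KolyvaginDepthDoor

open Literature.NumberTheory.EllipticCurves Literature.NumberTheory.EllipticCurves.ModularForms
  WeierstrassCurve
open Summit.BirchSwinnertonDyer.BirchSwinnertonDyer.Rank2Observatory
open Summit.BirchSwinnertonDyer.BirchSwinnertonDyer.Rank1Residual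
open Summit.BirchSwinnertonDyer.Rank1Residual.Additive


/-! ## `389a1`: the next two Kolyvagin primes for `(p, d_K) = (5, -7)`: `ℓ = 349, 419` -/

namespace C389a1

/-- `#Ẽ(𝔽_349) = 360`, `a_349 = -10` (Kolyvagin prime: `5 ∣ 349 + 1`, `5 ∣ a_349`) for `389a1`, kernel-decided (`ℕ`-arithmetic Euler
count `PointCountNat.natCard_point_map_eq`). [cite: CremonaAlgorithms1997, Table 1 (389a1)] -/
theorem card_349 :
    Nat.card (((⟨0, 1, 1, -2, 0⟩ : WeierstrassCurve ℤ).map (Int.castRingHom (ZMod 349))).toAffine.Point) = 360 := by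
  rw [PointCountNat.natCard_point_map_eq (hℓ := ⟨by norm_num⟩) (by norm_num) 0 1 1 (-2) 0
    (by decide +kernel)]
  decide +kernel

/-- `ℓ = 349` is a Kolyvagin prime for `(389a1, p = 5, d_K = -7)` with `M(349) ≥ 1`: `349` inert
(`(-7/349) = −1`), `5 ∣ 350`, `5 ∣ a_349 = -10`; JLS cost `[K[349] : K] = 350`. [cite: WZhang2014, Notations (xii)] -/
theorem isKolyvaginPrime_349_neg7 (K : Type) [Field K] [NumberField K]
    (h2 : Module.finrank ℚ K = 2) (hD : NumberField.discr K = -7) :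
    haveI := curve389a1_isGloballyMinimal;
    Zhang2014.IsKolyvaginPrime (Curve389a1.E.conductorNorm ℤ) Curve389a1.E K 5 349 ∧
      (1 : ℕ∞) ≤ Zhang2014.levelIndex Curve389a1.E 5 349 := by
  haveI := Fact.mk (by norm_num : Nat.Prime 5)
  haveI := curve389a1_isGloballyMinimal
  exact isKolyvaginPrime_of_intModel_certificate intModel 5 K h2 hD 349 (by norm_num) (by norm_num)
    (by decide +kernel) (by norm_num) (by norm_num) (by norm_num) (by norm_num) (n := 360) card_349
    (by norm_num)

/-- `#Ẽ(𝔽_419) = 455`, `a_419 = -35` (Kolyvagin prime: `5 ∣ 419 + 1`, `5 ∣ a_419`) for `389a1`, kernel-decided (`ℕ`-arithmetic Euler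
count `PointCountNat.natCard_point_map_eq`). [cite: CremonaAlgorithms1997, Table 1 (389a1)] -/
theorem card_419 :
    Nat.card (((⟨0, 1, 1, -2, 0⟩ : WeierstrassCurve ℤ).map (Int.castRingHom (ZMod 419))).toAffine.Point) = 455 := by
  rw [PointCountNat.natCard_point_map_eq (hℓ := ⟨by norm_num⟩) (by norm_num) 0 1 1 (-2) 0
    (by decide +kernel)]
  decide +kernel

/-- `ℓ = 419` is a Kolyvagin prime for `(389a1, p = 5, d_K = -7)` with `M(419) ≥ 1`: `419` inert
(`(-7/419) = −1`), `5 ∣ 420`, `5 ∣ a_419 = -35`; JLS cost `[K[419] : K] = 420`. [cite: WZhang2014, Notations (xii)] -/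
theorem isKolyvaginPrime_419_neg7 (K : Type) [Field K] [NumberField K]
    (h2 : Module.finrank ℚ K = 2) (hD : NumberField.discr K = -7) :
    haveI := curve389a1_isGloballyMinimal;
    Zhang2014.IsKolyvaginPrime (Curve389a1.E.conductorNorm ℤ) Curve389a1.E K 5 419 ∧
      (1 : ℕ∞) ≤ Zhang2014.levelIndex Curve389a1.E 5 419 := by
  haveI := Fact.mk (by norm_num : Nat.Prime 5)
  haveI := curve389a1_isGloballyMinimal
  exact isKolyvaginPrime_of_intModel_certificate intModel 5 K h2 hD 419 (by norm_num) (by norm_num)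
    (by decide +kernel) (by norm_num) (by norm_num) (by norm_num) (by norm_num) (n := 455) card_419
    (by norm_num)

end C389a1

/-! ## `433a1`: the next two Kolyvagin primes for `(p, d_K) = (5, -8)`: `ℓ = 199, 389` -/

namespace C433a1

/-- `#Ẽ(𝔽_199) = 210`, `a_199 = -10` (Kolyvagin prime: `5 ∣ 199 + 1`, `5 ∣ a_199`) for `433a1`, kernel-decided (`ℕ`-arithmetic Euler
count `PointCountNat.natCard_point_map_eq`). [cite: CremonaAlgorithms1997, Table 1 (433a1)] -/
theorem card_199 :
    Nat.card (((⟨1, 0, 0, 0, 1⟩ : WeierstrassCurve ℤ).map (Int.castRingHom (ZMod 199))).toAffine.Point) = 210 := by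
  rw [PointCountNat.natCard_point_map_eq (hℓ := ⟨by norm_num⟩) (by norm_num) 1 0 0 0 1
    (by decide +kernel)]
  decide +kernel

/-- `ℓ = 199` is a Kolyvagin prime for `(433a1, p = 5, d_K = -8)` with `M(199) ≥ 1`: `199` inert
(`(-8/199) = −1`), `5 ∣ 200`, `5 ∣ a_199 = -10`; JLS cost `[K[199] : K] = 200`. [cite: WZhang2014, Notations (xii)] -/
theorem isKolyvaginPrime_199_neg8 (K : Type) [Field K] [NumberField K]
    (h2 : Module.finrank ℚ K = 2) (hD : NumberField.discr K = -8) :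
    haveI := isGloballyMinimal_c433a1;
    Zhang2014.IsKolyvaginPrime (((⟨1, 0, 0, 0, 1⟩ : WeierstrassCurve ℤ).map (Int.castRingHom ℚ)).conductorNorm ℤ) ((⟨1, 0, 0, 0, 1⟩ : WeierstrassCurve ℤ).map (Int.castRingHom ℚ)) K 5 199 ∧
      (1 : ℕ∞) ≤ Zhang2014.levelIndex ((⟨1, 0, 0, 0, 1⟩ : WeierstrassCurve ℤ).map (Int.castRingHom ℚ)) 5 199 := by
  haveI := Fact.mk (by norm_num : Nat.Prime 5)
  haveI := isElliptic_c433a1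
  haveI := isGloballyMinimal_c433a1
  exact isKolyvaginPrime_of_intModel_certificate intModel 5 K h2 hD 199 (by norm_num) (by norm_num)
    (by decide +kernel) (by norm_num) (by norm_num) (by norm_num) (by norm_num) (n := 210) card_199
    (by norm_num)

/-- `#Ẽ(𝔽_389) = 415`, `a_389 = -25` (Kolyvagin prime: `5 ∣ 389 + 1`, `5 ∣ a_389`) for `433a1`, kernel-decided (`ℕ`-arithmetic Euler
count `PointCountNat.natCard_point_map_eq`). [cite: CremonaAlgorithms1997, Table 1 (433a1)] -/
theorem card_389 :
    Nat.card (((⟨1, 0, 0, 0, 1⟩ : WeierstrassCurve ℤ).map (Int.castRingHom (ZMod 389))).toAffine.Point) = 415 := by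
  rw [PointCountNat.natCard_point_map_eq (hℓ := ⟨by norm_num⟩) (by norm_num) 1 0 0 0 1
    (by decide +kernel)]
  decide +kernel

/-- `ℓ = 389` is a Kolyvagin prime for `(433a1, p = 5, d_K = -8)` with `M(389) ≥ 1`: `389` inert
(`(-8/389) = −1`), `5 ∣ 390`, `5 ∣ a_389 = -25`; JLS cost `[K[389] : K] = 390`. [cite: WZhang2014, Notations (xii)] -/
theorem isKolyvaginPrime_389_neg8 (K : Type) [Field K] [NumberField K]
    (h2 : Module.finrank ℚ K = 2) (hD : NumberField.discr K = -8) :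
    haveI := isGloballyMinimal_c433a1;
    Zhang2014.IsKolyvaginPrime (((⟨1, 0, 0, 0, 1⟩ : WeierstrassCurve ℤ).map (Int.castRingHom ℚ)).conductorNorm ℤ) ((⟨1, 0, 0, 0, 1⟩ : WeierstrassCurve ℤ).map (Int.castRingHom ℚ)) K 5 389 ∧
      (1 : ℕ∞) ≤ Zhang2014.levelIndex ((⟨1, 0, 0, 0, 1⟩ : WeierstrassCurve ℤ).map (Int.castRingHom ℚ)) 5 389 := by
  haveI := Fact.mk (by norm_num : Nat.Prime 5)
  haveI := isElliptic_c433a1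
  haveI := isGloballyMinimal_c433a1
  exact isKolyvaginPrime_of_intModel_certificate intModel 5 K h2 hD 389 (by norm_num) (by norm_num)
    (by decide +kernel) (by norm_num) (by norm_num) (by norm_num) (by norm_num) (n := 415) card_389
    (by norm_num)

end C433a1

/-! ## `446d1`: the next two Kolyvagin primes for `(p, d_K) = (5, -23)`: `ℓ = 379, 1229` -/

namespace C446d1

/-- `#Ẽ(𝔽_379) = 360`, `a_379 = 20` (Kolyvagin prime: `5 ∣ 379 + 1`, `5 ∣ a_379`) for `446d1`, kernel-decided (`ℕ`-arithmetic Euler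
count `PointCountNat.natCard_point_map_eq`). [cite: CremonaAlgorithms1997, Table 1 (446d1)] -/
theorem card_379 :
    Nat.card (((⟨1, -1, 0, -4, 4⟩ : WeierstrassCurve ℤ).map (Int.castRingHom (ZMod 379))).toAffine.Point) = 360 := by
  rw [PointCountNat.natCard_point_map_eq (hℓ := ⟨by norm_num⟩) (by norm_num) 1 (-1) 0 (-4) 4
    (by decide +kernel)]
  decide +kernel

/-- `ℓ = 379` is a Kolyvagin prime for `(446d1, p = 5, d_K = -23)` with `M(379) ≥ 1`: `379` inert
(`(-23/379) = −1`), `5 ∣ 380`, `5 ∣ a_379 = 20`; JLS cost `[K[379] : K] = 1140`. [cite: WZhang2014, Notations (xii)] -/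
theorem isKolyvaginPrime_379_neg23 (K : Type) [Field K] [NumberField K]
    (h2 : Module.finrank ℚ K = 2) (hD : NumberField.discr K = -23) :
    haveI := isGloballyMinimal_c446d1;
    Zhang2014.IsKolyvaginPrime (((⟨1, -1, 0, -4, 4⟩ : WeierstrassCurve ℤ).map (Int.castRingHom ℚ)).conductorNorm ℤ) ((⟨1, -1, 0, -4, 4⟩ : WeierstrassCurve ℤ).map (Int.castRingHom ℚ)) K 5 379 ∧
      (1 : ℕ∞) ≤ Zhang2014.levelIndex ((⟨1, -1, 0, -4, 4⟩ : WeierstrassCurve ℤ).map (Int.castRingHom ℚ)) 5 379 := by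
  haveI := Fact.mk (by norm_num : Nat.Prime 5)
  haveI := isElliptic_c446d1
  haveI := isGloballyMinimal_c446d1
  exact isKolyvaginPrime_of_intModel_certificate intModel 5 K h2 hD 379 (by norm_num) (by norm_num)
    (by decide +kernel) (by norm_num) (by norm_num) (by norm_num) (by norm_num) (n := 360) card_379
    (by norm_num)

/-- `#Ẽ(𝔽_1229) = 1240`, `a_1229 = -10` (Kolyvagin prime: `5 ∣ 1229 + 1`, `5 ∣ a_1229`) for `446d1`, kernel-decided (`ℕ`-arithmetic Euler
count `PointCountNat.natCard_point_map_eq`). [cite: CremonaAlgorithms1997, Table 1 (446d1)] -/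
theorem card_1229 :
    Nat.card (((⟨1, -1, 0, -4, 4⟩ : WeierstrassCurve ℤ).map (Int.castRingHom (ZMod 1229))).toAffine.Point) = 1240 := by
  rw [PointCountNat.natCard_point_map_eq (hℓ := ⟨by norm_num⟩) (by norm_num) 1 (-1) 0 (-4) 4
    (by decide +kernel)]
  decide +kernel

/-- `ℓ = 1229` is a Kolyvagin prime for `(446d1, p = 5, d_K = -23)` with `M(1229) ≥ 1`: `1229` inert
(`(-23/1229) = −1`), `5 ∣ 1230`, `5 ∣ a_1229 = -10`; JLS cost `[K[1229] : K] = 3690`. [cite: WZhang2014, Notations (xii)] -/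
theorem isKolyvaginPrime_1229_neg23 (K : Type) [Field K] [NumberField K]
    (h2 : Module.finrank ℚ K = 2) (hD : NumberField.discr K = -23) :
    haveI := isGloballyMinimal_c446d1;
    Zhang2014.IsKolyvaginPrime (((⟨1, -1, 0, -4, 4⟩ : WeierstrassCurve ℤ).map (Int.castRingHom ℚ)).conductorNorm ℤ) ((⟨1, -1, 0, -4, 4⟩ : WeierstrassCurve ℤ).map (Int.castRingHom ℚ)) K 5 1229 ∧
      (1 : ℕ∞) ≤ Zhang2014.levelIndex ((⟨1, -1, 0, -4, 4⟩ : WeierstrassCurve ℤ).map (Int.castRingHom ℚ)) 5 1229 := by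
  haveI := Fact.mk (by norm_num : Nat.Prime 5)
  haveI := isElliptic_c446d1
  haveI := isGloballyMinimal_c446d1
  exact isKolyvaginPrime_of_intModel_certificate intModel 5 K h2 hD 1229 (by norm_num) (by norm_num)
    (by decide +kernel) (by norm_num) (by norm_num) (by norm_num) (by norm_num) (n := 1240) card_1229
    (by norm_num)

end C446d1

/-! ## `563a1`: the next two Kolyvagin primes for `(p, d_K) = (5, -8)`: `ℓ = 229, 239` -/

namespace C563a1

/-- `#Ẽ(𝔽_229) = 210`, `a_229 = 20` (Kolyvagin prime: `5 ∣ 229 + 1`, `5 ∣ a_229`) for `563a1`, kernel-decided (`ℕ`-arithmetic Euler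
count `PointCountNat.natCard_point_map_eq`). [cite: CremonaAlgorithms1997, Table 1 (563a1)] -/
theorem card_229 :
    Nat.card (((⟨1, 1, 1, -15, 16⟩ : WeierstrassCurve ℤ).map (Int.castRingHom (ZMod 229))).toAffine.Point) = 210 := by
  rw [PointCountNat.natCard_point_map_eq (hℓ := ⟨by norm_num⟩) (by norm_num) 1 1 1 (-15) 16
    (by decide +kernel)]
  decide +kernel

/-- `ℓ = 229` is a Kolyvagin prime for `(563a1, p = 5, d_K = -8)` with `M(229) ≥ 1`: `229` inert
(`(-8/229) = −1`), `5 ∣ 230`, `5 ∣ a_229 = 20`; JLS cost `[K[229] : K] = 230`. [cite: WZhang2014, Notations (xii)] -/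
theorem isKolyvaginPrime_229_neg8 (K : Type) [Field K] [NumberField K]
    (h2 : Module.finrank ℚ K = 2) (hD : NumberField.discr K = -8) :
    haveI := isGloballyMinimal_c563a1;
    Zhang2014.IsKolyvaginPrime (((⟨1, 1, 1, -15, 16⟩ : WeierstrassCurve ℤ).map (Int.castRingHom ℚ)).conductorNorm ℤ) ((⟨1, 1, 1, -15, 16⟩ : WeierstrassCurve ℤ).map (Int.castRingHom ℚ)) K 5 229 ∧
      (1 : ℕ∞) ≤ Zhang2014.levelIndex ((⟨1, 1, 1, -15, 16⟩ : WeierstrassCurve ℤ).map (Int.castRingHom ℚ)) 5 229 := by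
  haveI := Fact.mk (by norm_num : Nat.Prime 5)
  haveI := isElliptic_c563a1
  haveI := isGloballyMinimal_c563a1
  exact isKolyvaginPrime_of_intModel_certificate intModel 5 K h2 hD 229 (by norm_num) (by norm_num)
    (by decide +kernel) (by norm_num) (by norm_num) (by norm_num) (by norm_num) (n := 210) card_229
    (by norm_num)

/-- `#Ẽ(𝔽_239) = 230`, `a_239 = 10` (Kolyvagin prime: `5 ∣ 239 + 1`, `5 ∣ a_239`) for `563a1`, kernel-decided (`ℕ`-arithmetic Euler
count `PointCountNat.natCard_point_map_eq`). [cite: CremonaAlgorithms1997, Table 1 (563a1)] -/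
theorem card_239 :
    Nat.card (((⟨1, 1, 1, -15, 16⟩ : WeierstrassCurve ℤ).map (Int.castRingHom (ZMod 239))).toAffine.Point) = 230 := by
  rw [PointCountNat.natCard_point_map_eq (hℓ := ⟨by norm_num⟩) (by norm_num) 1 1 1 (-15) 16
    (by decide +kernel)]
  decide +kernel

/-- `ℓ = 239` is a Kolyvagin prime for `(563a1, p = 5, d_K = -8)` with `M(239) ≥ 1`: `239` inert
(`(-8/239) = −1`), `5 ∣ 240`, `5 ∣ a_239 = 10`; JLS cost `[K[239] : K] = 240`. [cite: WZhang2014, Notations (xii)] -/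
theorem isKolyvaginPrime_239_neg8 (K : Type) [Field K] [NumberField K]
    (h2 : Module.finrank ℚ K = 2) (hD : NumberField.discr K = -8) :
    haveI := isGloballyMinimal_c563a1;
    Zhang2014.IsKolyvaginPrime (((⟨1, 1, 1, -15, 16⟩ : WeierstrassCurve ℤ).map (Int.castRingHom ℚ)).conductorNorm ℤ) ((⟨1, 1, 1, -15, 16⟩ : WeierstrassCurve ℤ).map (Int.castRingHom ℚ)) K 5 239 ∧
      (1 : ℕ∞) ≤ Zhang2014.levelIndex ((⟨1, 1, 1, -15, 16⟩ : WeierstrassCurve ℤ).map (Int.castRingHom ℚ)) 5 239 := by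
  haveI := Fact.mk (by norm_num : Nat.Prime 5)
  haveI := isElliptic_c563a1
  haveI := isGloballyMinimal_c563a1
  exact isKolyvaginPrime_of_intModel_certificate intModel 5 K h2 hD 239 (by norm_num) (by norm_num)
    (by decide +kernel) (by norm_num) (by norm_num) (by norm_num) (by norm_num) (n := 230) card_239
    (by norm_num)

end C563a1

/-! ## `571b1`: the next two Kolyvagin primes for `(p, d_K) = (5, -8)`: `ℓ = 79, 149` -/

namespace C571b1

/-- `#Ẽ(𝔽_79) = 80`, `a_79 = 0` (Kolyvagin prime: `5 ∣ 79 + 1`, `5 ∣ a_79`) for `571b1`, kernel-decided (`ℕ`-arithmetic Euler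
count `PointCountNat.natCard_point_map_eq`). [cite: CremonaAlgorithms1997, Table 1 (571b1)] -/
theorem card_79 :
    Nat.card (((⟨0, 1, 1, -4, 2⟩ : WeierstrassCurve ℤ).map (Int.castRingHom (ZMod 79))).toAffine.Point) = 80 := by
  rw [PointCountNat.natCard_point_map_eq (hℓ := ⟨by norm_num⟩) (by norm_num) 0 1 1 (-4) 2
    (by decide +kernel)]
  decide +kernel

/-- `ℓ = 79` is a Kolyvagin prime for `(571b1, p = 5, d_K = -8)` with `M(79) ≥ 1`: `79` inert
(`(-8/79) = −1`), `5 ∣ 80`, `5 ∣ a_79 = 0`; JLS cost `[K[79] : K] = 80`. [cite: WZhang2014, Notations (xii)] -/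
theorem isKolyvaginPrime_79_neg8 (K : Type) [Field K] [NumberField K]
    (h2 : Module.finrank ℚ K = 2) (hD : NumberField.discr K = -8) :
    haveI := isGloballyMinimal_c571b1;
    Zhang2014.IsKolyvaginPrime (((⟨0, 1, 1, -4, 2⟩ : WeierstrassCurve ℤ).map (Int.castRingHom ℚ)).conductorNorm ℤ) ((⟨0, 1, 1, -4, 2⟩ : WeierstrassCurve ℤ).map (Int.castRingHom ℚ)) K 5 79 ∧
      (1 : ℕ∞) ≤ Zhang2014.levelIndex ((⟨0, 1, 1, -4, 2⟩ : WeierstrassCurve ℤ).map (Int.castRingHom ℚ)) 5 79 := by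
  haveI := Fact.mk (by norm_num : Nat.Prime 5)
  haveI := isElliptic_c571b1
  haveI := isGloballyMinimal_c571b1
  exact isKolyvaginPrime_of_intModel_certificate intModel 5 K h2 hD 79 (by norm_num) (by norm_num)
    (by decide +kernel) (by norm_num) (by norm_num) (by norm_num) (by norm_num) (n := 80) card_79
    (by norm_num)

/-- `#Ẽ(𝔽_149) = 155`, `a_149 = -5` (Kolyvagin prime: `5 ∣ 149 + 1`, `5 ∣ a_149`) for `571b1`, kernel-decided (`ℕ`-arithmetic Euler
count `PointCountNat.natCard_point_map_eq`). [cite: CremonaAlgorithms1997, Table 1 (571b1)] -/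
theorem card_149 :
    Nat.card (((⟨0, 1, 1, -4, 2⟩ : WeierstrassCurve ℤ).map (Int.castRingHom (ZMod 149))).toAffine.Point) = 155 := by
  rw [PointCountNat.natCard_point_map_eq (hℓ := ⟨by norm_num⟩) (by norm_num) 0 1 1 (-4) 2
    (by decide +kernel)]
  decide +kernel

/-- `ℓ = 149` is a Kolyvagin prime for `(571b1, p = 5, d_K = -8)` with `M(149) ≥ 1`: `149` inert
(`(-8/149) = −1`), `5 ∣ 150`, `5 ∣ a_149 = -5`; JLS cost `[K[149] : K] = 150`. [cite: WZhang2014, Notations (xii)] -/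
theorem isKolyvaginPrime_149_neg8 (K : Type) [Field K] [NumberField K]
    (h2 : Module.finrank ℚ K = 2) (hD : NumberField.discr K = -8) :
    haveI := isGloballyMinimal_c571b1;
    Zhang2014.IsKolyvaginPrime (((⟨0, 1, 1, -4, 2⟩ : WeierstrassCurve ℤ).map (Int.castRingHom ℚ)).conductorNorm ℤ) ((⟨0, 1, 1, -4, 2⟩ : WeierstrassCurve ℤ).map (Int.castRingHom ℚ)) K 5 149 ∧
      (1 : ℕ∞) ≤ Zhang2014.levelIndex ((⟨0, 1, 1, -4, 2⟩ : WeierstrassCurve ℤ).map (Int.castRingHom ℚ)) 5 149 := by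
  haveI := Fact.mk (by norm_num : Nat.Prime 5)
  haveI := isElliptic_c571b1
  haveI := isGloballyMinimal_c571b1
  exact isKolyvaginPrime_of_intModel_certificate intModel 5 K h2 hD 149 (by norm_num) (by norm_num)
    (by decide +kernel) (by norm_num) (by norm_num) (by norm_num) (by norm_num) (n := 155) card_149
    (by norm_num)

end C571b1

/-! ## `643a1`: the next two Kolyvagin primes for `(p, d_K) = (5, -8)`: `ℓ = 269, 509` -/

namespace C643a1

/-- `#Ẽ(𝔽_269) = 285`, `a_269 = -15` (Kolyvagin prime: `5 ∣ 269 + 1`, `5 ∣ a_269`) for `643a1`, kernel-decided (`ℕ`-arithmetic Euler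
count `PointCountNat.natCard_point_map_eq`). [cite: CremonaAlgorithms1997, Table 1 (643a1)] -/
theorem card_269 :
    Nat.card (((⟨1, 0, 0, -4, 3⟩ : WeierstrassCurve ℤ).map (Int.castRingHom (ZMod 269))).toAffine.Point) = 285 := by
  rw [PointCountNat.natCard_point_map_eq (hℓ := ⟨by norm_num⟩) (by norm_num) 1 0 0 (-4) 3
    (by decide +kernel)]
  decide +kernel

/-- `ℓ = 269` is a Kolyvagin prime for `(643a1, p = 5, d_K = -8)` with `M(269) ≥ 1`: `269` inert
(`(-8/269) = −1`), `5 ∣ 270`, `5 ∣ a_269 = -15`; JLS cost `[K[269] : K] = 270`. [cite: WZhang2014, Notations (xii)] -/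
theorem isKolyvaginPrime_269_neg8 (K : Type) [Field K] [NumberField K]
    (h2 : Module.finrank ℚ K = 2) (hD : NumberField.discr K = -8) :
    haveI := isGloballyMinimal_c643a1;
    Zhang2014.IsKolyvaginPrime (((⟨1, 0, 0, -4, 3⟩ : WeierstrassCurve ℤ).map (Int.castRingHom ℚ)).conductorNorm ℤ) ((⟨1, 0, 0, -4, 3⟩ : WeierstrassCurve ℤ).map (Int.castRingHom ℚ)) K 5 269 ∧
      (1 : ℕ∞) ≤ Zhang2014.levelIndex ((⟨1, 0, 0, -4, 3⟩ : WeierstrassCurve ℤ).map (Int.castRingHom ℚ)) 5 269 := by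
  haveI := Fact.mk (by norm_num : Nat.Prime 5)
  haveI := isElliptic_c643a1
  haveI := isGloballyMinimal_c643a1
  exact isKolyvaginPrime_of_intModel_certificate intModel 5 K h2 hD 269 (by norm_num) (by norm_num)
    (by decide +kernel) (by norm_num) (by norm_num) (by norm_num) (by norm_num) (n := 285) card_269
    (by norm_num)

/-- `#Ẽ(𝔽_509) = 480`, `a_509 = 30` (Kolyvagin prime: `5 ∣ 509 + 1`, `5 ∣ a_509`) for `643a1`, kernel-decided (`ℕ`-arithmetic Euler
count `PointCountNat.natCard_point_map_eq`). [cite: CremonaAlgorithms1997, Table 1 (643a1)] -/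
theorem card_509 :
    Nat.card (((⟨1, 0, 0, -4, 3⟩ : WeierstrassCurve ℤ).map (Int.castRingHom (ZMod 509))).toAffine.Point) = 480 := by
  rw [PointCountNat.natCard_point_map_eq (hℓ := ⟨by norm_num⟩) (by norm_num) 1 0 0 (-4) 3
    (by decide +kernel)]
  decide +kernel

/-- `ℓ = 509` is a Kolyvagin prime for `(643a1, p = 5, d_K = -8)` with `M(509) ≥ 1`: `509` inert
(`(-8/509) = −1`), `5 ∣ 510`, `5 ∣ a_509 = 30`; JLS cost `[K[509] : K] = 510`. [cite: WZhang2014, Notations (xii)] -/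
theorem isKolyvaginPrime_509_neg8 (K : Type) [Field K] [NumberField K]
    (h2 : Module.finrank ℚ K = 2) (hD : NumberField.discr K = -8) :
    haveI := isGloballyMinimal_c643a1;
    Zhang2014.IsKolyvaginPrime (((⟨1, 0, 0, -4, 3⟩ : WeierstrassCurve ℤ).map (Int.castRingHom ℚ)).conductorNorm ℤ) ((⟨1, 0, 0, -4, 3⟩ : WeierstrassCurve ℤ).map (Int.castRingHom ℚ)) K 5 509 ∧
      (1 : ℕ∞) ≤ Zhang2014.levelIndex ((⟨1, 0, 0, -4, 3⟩ : WeierstrassCurve ℤ).map (Int.castRingHom ℚ)) 5 509 := by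
  haveI := Fact.mk (by norm_num : Nat.Prime 5)
  haveI := isElliptic_c643a1
  haveI := isGloballyMinimal_c643a1
  exact isKolyvaginPrime_of_intModel_certificate intModel 5 K h2 hD 509 (by norm_num) (by norm_num)
    (by decide +kernel) (by norm_num) (by norm_num) (by norm_num) (by norm_num) (n := 480) card_509
    (by norm_num)

end C643a1

end Summit.BirchSwinnertonDyer.BirchSwinnertonDyer.Theorems.KolyvaginDepthDoor

end
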